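import Summits.BirchSwinnertonDyer.BirchSwinnertonDyer.Theorems.KolyvaginDepthDoorDepthTableJLSRowsTwoSha
import Summits.BirchSwinnertonDyer.BirchSwinnertonDyer.Theorems.KolyvaginDepthDoorKolyvaginDepthSupplyDoorOfDatumPrintTwist
import Summits.BirchSwinnertonDyer.BirchSwinnertonDyer.Theorems.KolyvaginDepthDoorKNSupplyExactReadingDepthRow
import Summits.BirchSwinnertonDyer.BirchSwinnertonDyer.Theorems.KolyvaginDepthDoorDepthTableRowKitSecondSign
import Literature.NumberTheory.DiophantineGeometry.LocalReductionIsSemistableProofs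
import Summits.BirchSwinnertonDyer.BirchSwinnertonDyer.Theorems.Rank2ObservatoryKernelAnnihilator
import Literature.NumberTheory.EllipticCurves.LeadingTermProofs
import HarnessLib

/-!
# Route `KolyvaginDepthDoor` — «ONE PRINTED BIT, TWO `Ш`'s»: Jetchev–Lauter–Stein's three `p = 3`
# verifications (`389a1`, `709a1`, `718b1` at `(p, d_K, ℓ) = (3, −7, 5)`) certify, modulo (γ) ALONE,
# `Ш(E/ℚ)[3] = 0` AND `Ш(E^{(−7)}/ℚ)[3] = 0`, `rank E(ℚ) = 2` AND `rank E^{(−7)}(ℚ) = 1` — the twist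
# point supplied IN THE KERNEL (crux `KolyvaginDepthSupplyKN`, stmt-BirchSwinnertonDyer-22820) — 2/2: `718b1` and the three rows together

Helper file of the lead prover of line `levelone` (kdd-p1 g15; `--supports stmt-BirchSwinnertonDyer-22820
--as helper`); it closes nothing and BSD is not proved by it.

g14's «one bit, two `Ш`'s» (`twist_rank_eq_and_sha_trivial_of_kolyvaginClass_depth_ne_zero`, stated for
`p ≥ 5`) says: a non-zero first class at the «points first» depth `ν`, together with `ν` known points on
the Heegner twist, gives `Ш[p] = 0` for BOTH `E` and `E^{(d_K)}` and pins both ranks — Kolyvagin's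
second eigen-bound `#Sel_p(E^{(d_K)}) ≤ p^ν` read against the known points (AEC X.4.2), no
Gross–Zagier–Kolyvagin input on the twist. The depth table has exactly three rows WITH A PRINTED BIT,
all at `p = 3` (JLS 2009, Prop. 3.10 / Rem. 3.11; Literature fact
`JetchevLauterStein2009_kolyvaginClass_five_ne_zero_at_three`, `hJ`). This file runs the «two `Ш`'s»
reading on them, at `p = 3` (the door needs only `p` odd plus — at `p = 3` — «no additive place of type
IV / IV*», void here: the three curves are semistable) and with the ONE point on each `−7`-twist
supplied in the kernel:

* twist models `[0, −7 b₂, 0, 392 b₄, −5488 b₆]` (`u = 1/2`-isomorphic to `E^{(−7)}`,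
  `mordellWeilRank_quadraticTwist_eq_twistModel`): `389a1^{(−7)} ≅ [0, −28, 0, −1568, −5488]`,
  `709a1^{(−7)} ≅ [0, 28, 0, −1568, −5488]`, `718b1^{(−7)} ≅ [0, −7, 0, −3528, −5488]`;
* rational points of infinite order on them, IN THE KERNEL: the integral points `(64, 204)`, `(32, 76)`,
  `(92, 624)` (naive search) are non-zero and the twists are TORSION-FREE (annihilator `t = 1` from kernel
  point counts at two or three good primes, `nsmul_eq_zero_of_annihilatorCheck`), so Mordell–Weil gives
  `1 ≤ rank` (`one_le_mordellWeilRank_of_not_isOfFinAddOrder`);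
* `C<label>.AtThree.jlsRow_3_neg7_5_twoSha` — binders `(h372 : (γ)) (hJ : JLS)` ONLY, for ANY imaginary
  quadratic `K` with `d_K = −7`: `rank_ℤ E(ℚ) = 2`, `Ш(E/ℚ)[3] = 0`, `rank_ℤ E^{(−7)}(ℚ) = 1`,
  `E^{(−7)}(ℚ)[3] = 0`, `Ш(E^{(−7)}/ℚ)[3] = 0`;
* `jlsRows_twoSha` — the three rows together: SIX vanishing `Ш[3]`'s (`389a1`, `709a1`, `718b1` and their
  `−7`-twists of conductors `19061`, `34741`, `35182`) from three printed bits and (γ).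

`p = 3` CALIBRATES (the crux has `p ≥ 5`); CONDITIONAL on (γ) and `hJ`; per curve; BSD is NOT proved by
any of this.

References: [JetchevLauterStein2009] §3.6 Prop. 3.10, Rem. 3.11 (arXiv:0707.0032 p. 8); [GrossLMS1991]
Prop. 3.7 (2), §5 (5.1); [Kolyvagin1991MathAnn] Thm. 2.3; [SilvermanAEC2009] VII.3.4, X.4.2, X.5 Cor. 5.4;
[CremonaAlgorithms1997] Table 1.
-/

set_option linter.dupNamespace false

noncomputable section

open scoped Classical NumberField

namespace Summit.BirchSwinnertonDyer.BirchSwinnertonDyer.Theorems.KolyvaginDepthDoor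

open Literature.NumberTheory.EllipticCurves Literature.NumberTheory.EllipticCurves.ModularForms
  Literature.NumberTheory.EllipticCurves.McCallum1991 WeierstrassCurve IsDedekindDomain
open Summit.BirchSwinnertonDyer.BirchSwinnertonDyer.Rank2Observatory
open Summit.BirchSwinnertonDyer.BirchSwinnertonDyer.Rank1Residual

namespace C718b1.AtThree

/-- The twist model of `E^{(−7)}` for `E = 718b1`: `[0, −7 b₂, 0, 392 b₄, −5488 b₆] = [0, -7, 0, -3528, -5488]`
(`ℚ`-isomorphic to `E^{(−7)}` by `u = 1/2`). [cite: SilvermanAEC2009, X.5 Cor. 5.4] -/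
theorem twistModel_neg7 :
    (⟨0, (-7) * (⟨1, 0, 1, -5, 0⟩ : WeierstrassCurve ℤ).b₂, 0, 8 * (-7) ^ 2 * (⟨1, 0, 1, -5, 0⟩ : WeierstrassCurve ℤ).b₄,
        16 * (-7) ^ 3 * (⟨1, 0, 1, -5, 0⟩ : WeierstrassCurve ℤ).b₆⟩ : WeierstrassCurve ℤ) = ⟨0, -7, 0, -3528, -5488⟩ := by
  ext <;> decide +kernel

/-- The twist model `[0, -7, 0, -3528, -5488]` is an elliptic curve over `ℚ` (`Δ ≠ 0`, kernel-checked). [folklore] -/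
theorem isElliptic_twist_neg7 : ((⟨0, -7, 0, -3528, -5488⟩ : WeierstrassCurve ℤ).map (Int.castRingHom ℚ)).IsElliptic := by
  rw [WeierstrassCurve.isElliptic_iff, WeierstrassCurve.map_Δ, isUnit_iff_ne_zero, eq_intCast,
    Int.cast_ne_zero]
  decide +kernel

/-- Torsion killers for the twist model `[0, -7, 0, -3528, -5488]`: kernel point counts `(q, #Ṽ(𝔽_q))` at the good
primes `(3, 2), (5, 3), (17, 23)`. [cite: SilvermanAEC2009, Prop. VII.3.1 (b)] -/
theorem killers_twist_neg7 : ∀ ℓN ∈ [((3 : ℕ), (2 : ℕ)), ((5 : ℕ), (3 : ℕ)), ((17 : ℕ), (23 : ℕ))], ℓN.1.Prime ∧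
    ∀ (x : ((⟨0, -7, 0, -3528, -5488⟩ : WeierstrassCurve ℤ).map (Int.castRingHom ℚ)).toAffine.Point)
      (n : ℕ), ¬ ℓN.1 ∣ n → n • x = 0 → ℓN.2 • x = 0 :=
  killers_cons _ (q := 3) (N := 2) (by decide +kernel) (by decide +kernel)
    (killers_cons _ (q := 5) (N := 3) (by decide +kernel) (by decide +kernel)
      (killers_cons _ (q := 17) (N := 23) (by decide +kernel) (by decide +kernel)
        (killers_nil _)))

/-- **`E^{(−7)}(ℚ)` is torsion-free** on the twist model `[0, -7, 0, -3528, -5488]` (annihilator `t = 1` from the kernel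
counts `(3, 2), (5, 3), (17, 23)`). [cite: SilvermanAEC2009, Prop. VII.3.1 (b)] -/
theorem torsionFree_twist_neg7 (x : ((⟨0, -7, 0, -3528, -5488⟩ : WeierstrassCurve ℤ).map (Int.castRingHom ℚ)).toAffine.Point)
    (hx : IsOfFinAddOrder x) : x = 0 := by
  simpa only [one_smul] using
    nsmul_eq_zero_of_annihilatorCheck (t := 1) killers_twist_neg7 (by decide +kernel) hx

/-- **`1 ≤ rank_ℤ E^{(−7)}(ℚ)` for `E = 718b1` IN THE KERNEL**, on the twist model `[0, -7, 0, -3528, -5488]`: the integral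
point `(92, 624)` (naive search) is non-zero, and the twist is torsion-free (`torsionFree_twist_neg7`),
so it has infinite order; Mordell–Weil (`module_finite_point_holds`) turns it into `1 ≤ rank`.
[cite: SilvermanAEC2009, Prop. VII.3.1 (b) and Thm. VIII.6.7] -/
theorem one_le_rank_twist_neg7 :
    1 ≤ ((⟨0, -7, 0, -3528, -5488⟩ : WeierstrassCurve ℤ).map (Int.castRingHom ℚ)).mordellWeilRank := by
  haveI := isElliptic_twist_neg7
  have hP : ((⟨0, -7, 0, -3528, -5488⟩ : WeierstrassCurve ℤ).map (Int.castRingHom ℚ)).toAffine.Nonsingular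
      (92 : ℚ) (624 : ℚ) :=
    WeierstrassCurve.Affine.equation_iff_nonsingular.mp
      ((WeierstrassCurve.Affine.equation_iff _ _).mpr (by norm_num [WeierstrassCurve.map]))
  exact one_le_mordellWeilRank_of_not_isOfFinAddOrder _
    (((⟨0, -7, 0, -3528, -5488⟩ : WeierstrassCurve ℤ).map (Int.castRingHom ℚ)).module_finite_point_holds)
    (fun hfin ↦ WeierstrassCurve.Affine.Point.some_ne_zero hP (torsionFree_twist_neg7 _ (by convert hfin)))

/-- **«ONE PRINTED BIT, TWO `Ш`'s» — JLS ROW `718b1` at `(p, d_K, ℓ) = (3, −7, 5)`.** Granted (γ) (Gross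
1991 Prop. 3.7 (2)) and the published computation `hJ` (JLS 2009 Remark 3.11: a datum of conductor `5` with
`c_1(5) ≠ 0`), for ANY imaginary quadratic `K` with `d_K = −7`: `rank_ℤ E(ℚ) = 2`, `Ш(E/ℚ)[3] = 0`,
`rank_ℤ E^{(−7)}(ℚ) = 1`, `#E^{(−7)}(ℚ)[3] = 1` and `Ш(E^{(−7)}/ℚ)[3] = 0` (`E^{(−7)}` of conductor `35182`).
Door of a datum at `p = 3` on the Kodaira–Néron cell ((γ) only; semistable ⟹ no additive place) +
Kolyvagin's second eigen-bound `#Sel_3(E^{(−7)}) ≤ 3` read against the kernel point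
`one_le_rank_twist_neg7` (`rank_and_sha_of_natCard_selmerGroup_le`). CONDITIONAL on (γ) and `hJ`;
calibration (`p = 3 < 5`); BSD is not proved by it.
[cite: JetchevLauterStein2009, §3.6 Remark 3.11 (arXiv:0707.0032 p. 8)] [cite: GrossLMS1991, Prop. 3.7 (2), §5 (5.1)]
[cite: Kolyvagin1991MathAnn, Thm. 2.3] [cite: SilvermanAEC2009, Thm. X.4.2] -/
theorem jlsRow_3_neg7_5_twoSha
    (h372 : GrossLMS1991.prop37_2_frobeniusCongruence)
    (hJ : Literature.NumberTheory.EllipticCurves.JetchevLauterStein2009_kolyvaginClass_five_ne_zero_at_three)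
    (K : Type) [Field K] [NumberField K] (hIQ : IsImaginaryQuadratic K)
    (hD : NumberField.discr K = -7) :
    ((⟨1, 0, 1, -5, 0⟩ : WeierstrassCurve ℤ).map (Int.castRingHom ℚ)).mordellWeilRank = 2 ∧
      (((⟨1, 0, 1, -5, 0⟩ : WeierstrassCurve ℤ).map (Int.castRingHom ℚ)).sha ⊓ AddSubgroup.torsionBy ((⟨1, 0, 1, -5, 0⟩ : WeierstrassCurve ℤ).map (Int.castRingHom ℚ)).galH1 ((3 : ℕ) : ℤ) : AddSubgroup _) = ⊥ ∧
      (((⟨1, 0, 1, -5, 0⟩ : WeierstrassCurve ℤ).map (Int.castRingHom ℚ)).quadraticTwist (NumberField.discr K : ℚ)).mordellWeilRank = 1 ∧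
      Nat.card ↥(AddSubgroup.torsionBy (((⟨1, 0, 1, -5, 0⟩ : WeierstrassCurve ℤ).map (Int.castRingHom ℚ)).quadraticTwist (NumberField.discr K : ℚ)).toAffine.Point
        ((3 : ℕ) : ℤ)) = 1 ∧
      ((((⟨1, 0, 1, -5, 0⟩ : WeierstrassCurve ℤ).map (Int.castRingHom ℚ)).quadraticTwist (NumberField.discr K : ℚ)).sha ⊓
          AddSubgroup.torsionBy (((⟨1, 0, 1, -5, 0⟩ : WeierstrassCurve ℤ).map (Int.castRingHom ℚ)).quadraticTwist (NumberField.discr K : ℚ)).galH1 ((3 : ℕ) : ℤ) :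
          AddSubgroup (((⟨1, 0, 1, -5, 0⟩ : WeierstrassCurve ℤ).map (Int.castRingHom ℚ)).quadraticTwist (NumberField.discr K : ℚ)).galH1) = ⊥ := by
  haveI := isElliptic_c718b1
  haveI := isGloballyMinimal_c718b1
  haveI : NeZero (((⟨1, 0, 1, -5, 0⟩ : WeierstrassCurve ℤ).map (Int.castRingHom ℚ)).conductorNorm ℤ) := neZero_conductorNorm_of_isElliptic _
  haveI := Fact.mk (by norm_num : Nat.Prime 3)
  -- the computed bit (JLS), a datum of conductor `5`
  obtain ⟨Dt, β, ι, d, hne⟩ := hJ.2.2 K hIQ hD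
  have hr : 2 ≤ ((⟨1, 0, 1, -5, 0⟩ : WeierstrassCurve ℤ).map (Int.castRingHom ℚ)).mordellWeilRank := KernelCerts002.C718b1.two_le_rank
  have hcm : ¬ ((⟨1, 0, 1, -5, 0⟩ : WeierstrassCurve ℤ).map (Int.castRingHom ℚ)).HasCM := C718b1.not_hasCM
  -- no additive place: `gcd(c₄, Δ) = 1`, semistable
  have hsemi : ((⟨1, 0, 1, -5, 0⟩ : WeierstrassCurve ℤ).map (Int.castRingHom ℚ)).IsSemistable (𝓞 ℚ) :=
    isSemistable_of_intModel_of_isCoprime C718b1.intModel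
      (by rw [Int.isCoprime_iff_gcd_eq_one]; decide +kernel)
  have hadd : ∀ v : HeightOneSpectrum (𝓞 ℚ), ((⟨1, 0, 1, -5, 0⟩ : WeierstrassCurve ℤ).map (Int.castRingHom ℚ)).HasAdditiveReductionAt v → (3 : ℕ) ≠ 3 ∨
      (((⟨1, 0, 1, -5, 0⟩ : WeierstrassCurve ℤ).map (Int.castRingHom ℚ)).kodairaSymbolAt v ≠ Literature.NumberTheory.DiophantineGeometry.KodairaSymbol.IV ∧
        ((⟨1, 0, 1, -5, 0⟩ : WeierstrassCurve ℤ).map (Int.castRingHom ℚ)).kodairaSymbolAt v ≠ Literature.NumberTheory.DiophantineGeometry.KodairaSymbol.IVstar) :=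
    fun v hv ↦ absurd hv
      ((WeierstrassCurve.isSemistable_iff_forall_not_hasAdditiveReductionAt (𝓞 ℚ) _).mp hsemi v)
  -- the per-curve side conditions of the door
  obtain ⟨hkol, -⟩ := isKolyvaginPrime_of_intModel_certificate C718b1.intModel 3 K hIQ.1 hD 5 (by norm_num)
    (by norm_num) (by decide +kernel) (by norm_num) (by norm_num) (by norm_num) (by norm_num) (n := 9)
    C718b1.card_5 (by norm_num)
  have hk₁ : ∀ q ∈ (5 : ℕ).primeFactors,
      Zhang2014.IsKolyvaginPrime (((⟨1, 0, 1, -5, 0⟩ : WeierstrassCurve ℤ).map (Int.castRingHom ℚ)).conductorNorm ℤ) ((⟨1, 0, 1, -5, 0⟩ : WeierstrassCurve ℤ).map (Int.castRingHom ℚ)) K 3 q := by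
    intro q hq
    rw [Nat.prime_five.primeFactors, Finset.mem_singleton] at hq
    exact hq ▸ hkol
  obtain ⟨c, hc, hcc⟩ := exists_conj_of_isImaginaryQuadratic K hIQ
  have hH' := satisfiesHeegnerHypothesis_conductorNorm_of_intModel C718b1.intModel K hIQ.1 hD C718b1.heegner_neg7
  have hmult : ∀ v : HeightOneSpectrum (𝓞 ℚ), ((⟨1, 0, 1, -5, 0⟩ : WeierstrassCurve ℤ).map (Int.castRingHom ℚ)).HasMultiplicativeReductionAt v →
      ¬ 3 ∣ ((⟨1, 0, 1, -5, 0⟩ : WeierstrassCurve ℤ).map (Int.castRingHom ℚ)).ordMinimalDiscriminant v :=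
    not_dvd_ordMinimalDiscriminant_of_intModel_table C718b1.intModel (p := 3) (Δ₀ := 5744) (by decide +kernel)
      (B := 18) (by decide +kernel) (by decide +kernel)
  have hD3 : NumberField.discr K ≠ -3 := by rw [hD]; norm_num
  have hD4 : NumberField.discr K ≠ -4 := by rw [hD]; norm_num
  have hrank : (5 : ℕ).primeFactors.card + 1 ≤ ((⟨1, 0, 1, -5, 0⟩ : WeierstrassCurve ℤ).map (Int.castRingHom ℚ)).mordellWeilRank := by
    rw [Nat.prime_five.primeFactors, Finset.card_singleton]; exact hr
  -- the door ((γ) only): `rank E = 2`, `Ш(E)[3] = 0`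
  obtain ⟨-, hr2, -, -, hbot, -⟩ :=
    shaCorank_eq_zero_of_kolyvaginClass_ne_zero_of_rank_le_of_datum_kodairaNeron h372 hcm hIQ hD3 hD4 hH'
      3 (by norm_num) hasSurjectiveModNGaloisRep_pow_3 c hc hcc hmult hadd Nat.prime_five.prime.squarefree
      hk₁ d hne hrank
  -- Kolyvagin's second eigen-bound on the twist: `#Sel_3(E^{(d_K)}) ≤ 3`
  obtain ⟨-, hSelT, -⟩ :=
    natCard_selmerGroup_twist_le_of_kolyvaginClass_ne_zero_of_datum_kodairaNeron h372 hcm hIQ hD3 hD4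
      hH' 3 (by norm_num) hasSurjectiveModNGaloisRep_pow_3 c hc hcc hmult hadd Nat.prime_five.prime.squarefree
      hk₁ d hne hrank
  rw [pow_one] at hSelT
  -- the kernel point on the twist, moved to `W.quadraticTwist d_K`
  have hrank' : (5 : ℕ).primeFactors.card ≤
      (((⟨1, 0, 1, -5, 0⟩ : WeierstrassCurve ℤ).map (Int.castRingHom ℚ)).quadraticTwist (NumberField.discr K : ℚ)).mordellWeilRank := by
    rw [Nat.prime_five.primeFactors, Finset.card_singleton, hD,
      mordellWeilRank_quadraticTwist_eq_twistModel C718b1.intModel (-7), twistModel_neg7]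
    exact one_le_rank_twist_neg7
  have hdK : (NumberField.discr K : ℚ) ≠ 0 := by exact_mod_cast NumberField.discr_ne_zero K
  haveI := ((⟨1, 0, 1, -5, 0⟩ : WeierstrassCurve ℤ).map (Int.castRingHom ℚ)).isElliptic_quadraticTwist hdK
  obtain ⟨hr', ht', hbot', -⟩ :=
    rank_and_sha_of_natCard_selmerGroup_le (((⟨1, 0, 1, -5, 0⟩ : WeierstrassCurve ℤ).map (Int.castRingHom ℚ)).quadraticTwist (NumberField.discr K : ℚ))
      (by norm_num : 1 < 3) (5 : ℕ).primeFactors.card hSelT hrank'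
  rw [Nat.prime_five.primeFactors, Finset.card_singleton] at hr2 hr'
  exact ⟨hr2, by simpa only [pow_one] using hbot, hr', by convert ht', by convert hbot'⟩

end C718b1.AtThree

/-- **Six vanishing `Ш[3]`'s from three printed bits** (JLS 2009 Prop. 3.10 / Rem. 3.11 at `(3, −7, 5)`):
modulo (γ) and the published computation ONLY, for `E = 389a1`, `709a1`, `718b1` and ANY imaginary
quadratic `K` of discriminant `−7`: `Ш(E/ℚ)[3] = 0` and `Ш(E^{(d_K)}/ℚ)[3] = 0`, with `rank_ℤ E(ℚ) = 2`
and `rank_ℤ E^{(d_K)}(ℚ) = 1`. Calibration of the instrument (`p = 3 < 5`); BSD is not proved by it.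
[cite: JetchevLauterStein2009, §3.6 Prop. 3.10 and Remark 3.11 (arXiv:0707.0032 p. 8)]
[cite: GrossLMS1991, Prop. 3.7 (2)] [cite: SilvermanAEC2009, Thm. X.4.2] -/
theorem jlsRows_twoSha
    (h372 : GrossLMS1991.prop37_2_frobeniusCongruence)
    (hJ : Literature.NumberTheory.EllipticCurves.JetchevLauterStein2009_kolyvaginClass_five_ne_zero_at_three)
    (K : Type) [Field K] [NumberField K] (hIQ : IsImaginaryQuadratic K)
    (hD : NumberField.discr K = -7) :
    (((⟨0, 1, 1, -2, 0⟩ : WeierstrassCurve ℤ).map (Int.castRingHom ℚ)).mordellWeilRank = 2 ∧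
      (((⟨0, 1, 1, -2, 0⟩ : WeierstrassCurve ℤ).map (Int.castRingHom ℚ)).sha ⊓ AddSubgroup.torsionBy ((⟨0, 1, 1, -2, 0⟩ : WeierstrassCurve ℤ).map (Int.castRingHom ℚ)).galH1 ((3 : ℕ) : ℤ) : AddSubgroup _) = ⊥ ∧
      (((⟨0, 1, 1, -2, 0⟩ : WeierstrassCurve ℤ).map (Int.castRingHom ℚ)).quadraticTwist (NumberField.discr K : ℚ)).mordellWeilRank = 1 ∧
      ((((⟨0, 1, 1, -2, 0⟩ : WeierstrassCurve ℤ).map (Int.castRingHom ℚ)).quadraticTwist (NumberField.discr K : ℚ)).sha ⊓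
          AddSubgroup.torsionBy (((⟨0, 1, 1, -2, 0⟩ : WeierstrassCurve ℤ).map (Int.castRingHom ℚ)).quadraticTwist (NumberField.discr K : ℚ)).galH1 ((3 : ℕ) : ℤ) :
          AddSubgroup (((⟨0, 1, 1, -2, 0⟩ : WeierstrassCurve ℤ).map (Int.castRingHom ℚ)).quadraticTwist (NumberField.discr K : ℚ)).galH1) = ⊥) ∧
    (((⟨0, -1, 1, -2, 0⟩ : WeierstrassCurve ℤ).map (Int.castRingHom ℚ)).mordellWeilRank = 2 ∧
      (((⟨0, -1, 1, -2, 0⟩ : WeierstrassCurve ℤ).map (Int.castRingHom ℚ)).sha ⊓ AddSubgroup.torsionBy ((⟨0, -1, 1, -2, 0⟩ : WeierstrassCurve ℤ).map (Int.castRingHom ℚ)).galH1 ((3 : ℕ) : ℤ) : AddSubgroup _) = ⊥ ∧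
      (((⟨0, -1, 1, -2, 0⟩ : WeierstrassCurve ℤ).map (Int.castRingHom ℚ)).quadraticTwist (NumberField.discr K : ℚ)).mordellWeilRank = 1 ∧
      ((((⟨0, -1, 1, -2, 0⟩ : WeierstrassCurve ℤ).map (Int.castRingHom ℚ)).quadraticTwist (NumberField.discr K : ℚ)).sha ⊓
          AddSubgroup.torsionBy (((⟨0, -1, 1, -2, 0⟩ : WeierstrassCurve ℤ).map (Int.castRingHom ℚ)).quadraticTwist (NumberField.discr K : ℚ)).galH1 ((3 : ℕ) : ℤ) :
          AddSubgroup (((⟨0, -1, 1, -2, 0⟩ : WeierstrassCurve ℤ).map (Int.castRingHom ℚ)).quadraticTwist (NumberField.discr K : ℚ)).galH1) = ⊥) ∧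
    (((⟨1, 0, 1, -5, 0⟩ : WeierstrassCurve ℤ).map (Int.castRingHom ℚ)).mordellWeilRank = 2 ∧
      (((⟨1, 0, 1, -5, 0⟩ : WeierstrassCurve ℤ).map (Int.castRingHom ℚ)).sha ⊓ AddSubgroup.torsionBy ((⟨1, 0, 1, -5, 0⟩ : WeierstrassCurve ℤ).map (Int.castRingHom ℚ)).galH1 ((3 : ℕ) : ℤ) : AddSubgroup _) = ⊥ ∧
      (((⟨1, 0, 1, -5, 0⟩ : WeierstrassCurve ℤ).map (Int.castRingHom ℚ)).quadraticTwist (NumberField.discr K : ℚ)).mordellWeilRank = 1 ∧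
      ((((⟨1, 0, 1, -5, 0⟩ : WeierstrassCurve ℤ).map (Int.castRingHom ℚ)).quadraticTwist (NumberField.discr K : ℚ)).sha ⊓
          AddSubgroup.torsionBy (((⟨1, 0, 1, -5, 0⟩ : WeierstrassCurve ℤ).map (Int.castRingHom ℚ)).quadraticTwist (NumberField.discr K : ℚ)).galH1 ((3 : ℕ) : ℤ) :
          AddSubgroup (((⟨1, 0, 1, -5, 0⟩ : WeierstrassCurve ℤ).map (Int.castRingHom ℚ)).quadraticTwist (NumberField.discr K : ℚ)).galH1) = ⊥) := by
  obtain ⟨h1r, h1s, h1r', -, h1s'⟩ := C389a1.AtThree.jlsRow_3_neg7_5_twoSha h372 hJ K hIQ hD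
  obtain ⟨h2r, h2s, h2r', -, h2s'⟩ := C709a1.AtThree.jlsRow_3_neg7_5_twoSha h372 hJ K hIQ hD
  obtain ⟨h3r, h3s, h3r', -, h3s'⟩ := C718b1.AtThree.jlsRow_3_neg7_5_twoSha h372 hJ K hIQ hD
  exact ⟨⟨h1r, h1s, h1r', h1s'⟩, ⟨h2r, h2s, h2r', h2s'⟩, ⟨h3r, h3s, h3r', h3s'⟩⟩

end Summit.BirchSwinnertonDyer.BirchSwinnertonDyer.Theorems.KolyvaginDepthDoor

end
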